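import Summits.FinalStateConjecture.FinalStateConjecture.Theorems.EIHFluxBalanceInertialRecessionStubRechart3FrameDefect
import Summits.FinalStateConjecture.FinalStateConjecture.Theorems.EIHFluxBalanceInertialRecessionStubRechart3OwnTerm
import Summits.FinalStateConjecture.FinalStateConjecture.Theorems.EIHFluxBalanceInertialRecessionPullback
import Summits.FinalStateConjecture.FinalStateConjecture.Theorems.EIHFluxBalanceInertialRecessionAnsatzSmooth
import Literature.Geometry.Lorentzian.MultiCentreRadiationZone

/-!
# Route EIHFluxBalance — `InertialRecession`, re-charting: pointwise `C²` bound of the clock chart's deviation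

Helper file for the crux `stmt-FinalStateConjecture-10166`
(`Summit.FinalStateConjecture.FinalStateConjecture.Theses.EIHFluxBalance.InertialRecession`),
line `sublinear-is-free-clean-window-charges`, stub `stub_rechart` (the transfer P2), part G1.

Rest-frame hole chart `Ψ₁ = Φ ∘ A` on the Kerr exterior (`boostedKerrBackground 1 0 M a`), with `A`
agreeing near the point `y` with the honest chart `ψ` of the normalised frame `Λ̃` and clock `T₀`.
The re-charting identity (`…Pullback`) splits `Ψ₁^* g − g_{M,a}` at `y` into
* the transported lab deviation `(Φ^* g − g_B)(ψ ·)[Dψ ·, Dψ ·]`,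
* the MODEL DEFECT `g_B(ψ ·)[Dψ ·, Dψ ·] − g_{M,a}`, which by the own-summand identity of `…ClockMap`
  equals `(g_{M,a}[S·,S·] − g_{M,a}) + Σ_{j ≠ i} Hⱼ(ψ ·)[Dψ ·, Dψ ·]`, `S = 1 + E` the transported frame
  (`modelDefect_eq`).
`norm_iteratedFDeriv_deviation_clockChart_le` bounds the three pieces in `C²` at `y` by
`32 D⁴ η₁ + 30 C_K ε + N · 32 D⁴ η₂` (lab deviation `η₁`, frame defect `ε`, other summands `η₂`,
`‖Dʲψ‖ ≤ D`). [folklore]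
-/

noncomputable section

set_option linter.dupNamespace false

open Set Filter Function Metric Topology TopologicalSpace
open scoped ContDiff Manifold ENNReal BigOperators
open Literature.Geometry.Lorentzian

namespace Summit.FinalStateConjecture.FinalStateConjecture.Theorems.SublinearIsFree.Rechart

section Setting

variable {N : ℕ} (i : Fin N) (M a : Fin N → ℝ) (Λ : Fin N → ℝ → lorentzGroup) (ξ : Fin N → ℝ → E3)
  (Λt : ℝ → lorentzGroup) (T₀ : ℝ → ℝ)
  (hbil : ∀ t x, boostedKerrBilin (Λt t) (E4.ofTimeSpace t (ξ i t)) (M i) (a i) x =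
    boostedKerrBilin (Λ i t) (E4.ofTimeSpace t (ξ i t)) (M i) (a i) x)
  {H : Fin N → E4 → E4 →L[ℝ] E4 →L[ℝ] ℝ}
  (hH : ∀ j z, H j z = boostedKerrBilin (Λ j (z 0)) (E4.ofTimeSpace (z 0) (ξ j (z 0))) (M j) (a j) z -
    Minkowski.bilin)
  {Bb : E4 → E4 →L[ℝ] E4 →L[ℝ] ℝ} (hBb : ∀ z, Bb z = Minkowski.bilin + ∑ j, H j z)

/-! ### The model defect -/

include hbil hH hBb in
/-- **The model defect of the clock chart.** For every `z`,
`g_B(ψ z)[Dψ z ·, Dψ z ·] − g_{M,a}(z) = (g_{M,a}(z)[S z ·, S z ·] − g_{M,a}(z)) + Σ_{j ≠ i} Hⱼ(ψ z)[Dψ z ·, Dψ z ·]`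
with `S z = 1 + E(z)` the transported frame (`E` the frame defect). [folklore] -/
theorem modelDefect_eq (z : E4) :
    (Bb (honestChart Λt (ξ i) T₀ z)).bilinearComp (fderiv ℝ (honestChart Λt (ξ i) T₀) z)
        (fderiv ℝ (honestChart Λt (ξ i) T₀) z) - Kerr.bilin (M i) (a i) z =
      ((Kerr.bilin (M i) (a i) z).bilinearComp (ContinuousLinearMap.id ℝ E4 + frameDefect Λt (ξ i) T₀ z)
          (ContinuousLinearMap.id ℝ E4 + frameDefect Λt (ξ i) T₀ z) - Kerr.bilin (M i) (a i) z) +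
        ∑ j ∈ Finset.univ.erase i, (H j (honestChart Λt (ξ i) T₀ z)).bilinearComp
          (fderiv ℝ (honestChart Λt (ξ i) T₀) z) (fderiv ℝ (honestChart Λt (ξ i) T₀) z) := by
  set ψ := honestChart Λt (ξ i) T₀ with hψ
  set T := clockMap Λt T₀ with hT
  have hψ0 : ψ z 0 = T z := honestChart_apply_zero Λt (ξ i) T₀ z
  have hS : ∀ v : E4, (ContinuousLinearMap.id ℝ E4 + frameDefect Λt (ξ i) T₀ z) v =
      ((Λt (T z) : E4 ≃L[ℝ] E4)).symm (fderiv ℝ ψ z v) := fun v ↦ by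
    simp [frameDefect, hT, hψ]
  have hown : ∀ v w : E4, Minkowski.bilin (fderiv ℝ ψ z v) (fderiv ℝ ψ z w) +
      H i (ψ z) (fderiv ℝ ψ z v) (fderiv ℝ ψ z w) =
        Kerr.bilin (M i) (a i) z ((ContinuousLinearMap.id ℝ E4 + frameDefect Λt (ξ i) T₀ z) v)
          ((ContinuousLinearMap.id ℝ E4 + frameDefect Λt (ξ i) T₀ z) w) := fun v w ↦ by
    rw [hH, sub_apply, sub_apply, add_sub_cancel, hψ0, ← hbil, hS, hS]
    exact boostedKerrBilin_honestChart_apply Λt (ξ i) T₀ (M i) (a i) z _ _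
  refine ContinuousLinearMap.ext fun v ↦ ContinuousLinearMap.ext fun w ↦ ?_
  have key := hown v w
  simp only [add_apply, ContinuousLinearMap.coe_id', id_eq] at key
  simp only [hBb, sub_apply, add_apply, ContinuousLinearMap.bilinearComp_apply, sum_apply,
    ContinuousLinearMap.coe_id', id_eq]
  rw [← Finset.add_sum_erase _ _ (Finset.mem_univ i)]
  linarith

end Setting

/-! ### Smoothness of the frame defect -/

/-- The frame defect of a smooth frame, centre and clock is smooth. [folklore] -/
theorem contDiff_frameDefect (Λ : ℝ → lorentzGroup) (ξ : ℝ → E3) (T₀ : ℝ → ℝ)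
    (hΛ : ContDiff ℝ ∞ (fun t ↦ ((Λ t : E4 ≃L[ℝ] E4) : E4 →L[ℝ] E4))) (hξ : ContDiff ℝ ∞ ξ)
    (hT₀ : ContDiff ℝ ∞ T₀) : ContDiff ℝ ∞ (frameDefect Λ ξ T₀) := by
  have hFT : ContDiff ℝ ∞ (fun y ↦ (((Λ (clockMap Λ T₀ y) : E4 ≃L[ℝ] E4).symm : E4 ≃L[ℝ] E4) : E4 →L[ℝ] E4)) :=
    (contDiff_lorentz_symm Λ hΛ).comp (contDiff_clockMap Λ T₀ hΛ hT₀)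
  have hD : ContDiff ℝ ∞ (fderiv ℝ (honestChart Λ ξ T₀)) :=
    (contDiff_honestChart Λ ξ T₀ hΛ hξ hT₀).fderiv_right (m := ∞) le_rfl
  exact (hFT.clm_comp hD).sub contDiff_const

/-! ### The pointwise bound -/

section PointBound

variable (𝓢 : Spacetime 4) {N : ℕ} (i : Fin N) (M a : Fin N → ℝ) (Λ : Fin N → ℝ → lorentzGroup)
  (ξ : Fin N → ℝ → E3) (Λt : ℝ → lorentzGroup) (T₀ : ℝ → ℝ)
  (hbil : ∀ t x, boostedKerrBilin (Λt t) (E4.ofTimeSpace t (ξ i t)) (M i) (a i) x =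
    boostedKerrBilin (Λ i t) (E4.ofTimeSpace t (ξ i t)) (M i) (a i) x)
  (hrad : ∀ t x, Kerr.radius (a i) (poincareInv (Λt t) (E4.ofTimeSpace t (ξ i t)) x) =
    Kerr.radius (a i) (poincareInv (Λ i t) (E4.ofTimeSpace t (ξ i t)) x))
  {H : Fin N → E4 → E4 →L[ℝ] E4 →L[ℝ] ℝ}
  (hH : ∀ j z, H j z = boostedKerrBilin (Λ j (z 0)) (E4.ofTimeSpace (z 0) (ξ j (z 0))) (M j) (a j) z -
    Minkowski.bilin)
  {Bb : E4 → E4 →L[ℝ] E4 →L[ℝ] ℝ} (hBb : ∀ z, Bb z = Minkowski.bilin + ∑ j, H j z)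
  (hΛ : ∀ j, ContDiff ℝ ∞ (fun t ↦ ((Λ j t : E4 ≃L[ℝ] E4) : E4 →L[ℝ] E4)))
  (hξ : ∀ j, ContDiff ℝ ∞ (ξ j))
  (hΛt : ContDiff ℝ ∞ (fun t ↦ ((Λt t : E4 ≃L[ℝ] E4) : E4 →L[ℝ] E4))) (hT₀ : ContDiff ℝ ∞ T₀)
  (U : Opens E4) (Φ : U → 𝓢.carrier) (hΦ : ContMDiff 𝓘(ℝ, E4) (𝓡 4) ∞ Φ)
  {A : E4 → E4} (hAc : ContDiff ℝ ∞ A)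
  (hAU : ∀ y ∈ boostedKerrExterior 1 0 (M i) (a i), A y ∈ U)
  {Ψ₁ : boostedKerrExterior 1 0 (M i) (a i) → 𝓢.carrier}
  (hΨ₁ : ∀ y, Ψ₁ y = Φ ⟨A y.1, hAU y.1 y.2⟩)

include hbil hrad hH hBb hΛ hξ hΛt hT₀ hΦ hAc hΨ₁ in
-- long chain of `C²` bookkeeping
set_option maxHeartbeats 800000 in
/-- **Pointwise `C²` bound of the clock chart's deviation (rest frame).** At a point `y` of the
Kerr exterior near which `A` is the honest chart `ψ`, with `‖Dʲψ(y)‖ ≤ D` (`1 ≤ j ≤ 3`, `D ≥ 1`),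
`‖Dʲ g_{M,a}(y)‖ ≤ C_K` and frame defect `‖DʲE(y)‖ ≤ ε ≤ 1` (`j ≤ 2`), the other painted summands
`C²`-small (`≤ η₂`) with positive painted radius at `ψ y`, and the lab deviation `C²`-small (`≤ η₁`)
at `ψ y ∈ U`: `‖Dᵐ (Ψ₁^* g − g_{M,a})(y)‖ ≤ 32 D⁴ η₁ + 30 C_K ε + N · 32 D⁴ η₂` for `m ≤ 2`. [folklore] -/
theorem norm_iteratedFDeriv_deviation_clockChart_le {y : E4} (hy : y ∈ Kerr.exterior (M i) (a i))
    (hAeq : A =ᶠ[𝓝 y] honestChart Λt (ξ i) T₀) {D CK ε η₁ η₂ : ℝ} (hD1 : 1 ≤ D)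
    (hD : ∀ j, 1 ≤ j → j ≤ 3 → ‖iteratedFDeriv ℝ j (honestChart Λt (ξ i) T₀) y‖ ≤ D)
    (hCK : ∀ j ≤ 2, ‖iteratedFDeriv ℝ j (Kerr.bilin (M i) (a i)) y‖ ≤ CK) (hε0 : 0 ≤ ε) (hε1 : ε ≤ 1)
    (hEb : ∀ j ≤ 2, ‖iteratedFDeriv ℝ j (frameDefect Λt (ξ i) T₀) y‖ ≤ ε) (hη₁ : 0 ≤ η₁) (hη₂ : 0 ≤ η₂)
    (hoth : ∀ j ≠ i, 0 < Kerr.radius (a j) (poincareInv (Λ j (honestChart Λt (ξ i) T₀ y 0))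
        (E4.ofTimeSpace (honestChart Λt (ξ i) T₀ y 0) (ξ j (honestChart Λt (ξ i) T₀ y 0)))
        (honestChart Λt (ξ i) T₀ y)) ∧
      ∀ l ≤ 2, ‖iteratedFDeriv ℝ l (H j) (honestChart Λt (ξ i) T₀ y)‖ ≤ η₂)
    (hyU : honestChart Λt (ξ i) T₀ y ∈ U)
    (hdevb : ∀ l ≤ 2, ‖iteratedFDeriv ℝ l
      (𝓢.deviationExtend ⟨U, Bb, fun z ↦ z 0, E4.spatialNorm⟩ Φ) (honestChart Λt (ξ i) T₀ y)‖ ≤ η₁) :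
    ∀ m ≤ 2, ‖iteratedFDeriv ℝ m (𝓢.deviationExtend (boostedKerrBackground 1 0 (M i) (a i)) Ψ₁) y‖ ≤
      32 * D ^ 4 * η₁ + 30 * CK * ε + N * (32 * D ^ 4 * η₂) := by
  set ψ := honestChart Λt (ξ i) T₀ with hψdef
  set E := frameDefect Λt (ξ i) T₀ with hEdef
  set Bf : ModelBackground := ⟨U, Bb, fun z ↦ z 0, E4.spatialNorm⟩ with hBf
  set K : ModelBackground := boostedKerrBackground 1 0 (M i) (a i) with hK
  have hψc : ContDiff ℝ ∞ ψ := contDiff_honestChart Λt (ξ i) T₀ hΛt (hξ i) hT₀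
  have hEc : ContDiff ℝ ∞ E := contDiff_frameDefect Λt (ξ i) T₀ hΛt (hξ i) hT₀
  have hyK : y ∈ boostedKerrExterior 1 0 (M i) (a i) := by
    rw [mem_boostedKerrExterior, poincareInv_one, sub_zero]; exact hy
  have hr : 0 < Kerr.radius (a i) y := (le_max_right _ _).trans_lt (Kerr.mem_exterior.mp hy)
  -- the re-charting identity near `y`, with `A` replaced by `ψ`
  have hev1 := deviationExtend_comp_smooth_eventuallyEq (𝓢 := 𝓢) Bf K (f := A) (Φ := Φ) (Ψ := Ψ₁)
    hAc hAU hΨ₁ hΦ hyK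
  have hfd : fderiv ℝ A =ᶠ[𝓝 y] fderiv ℝ ψ := hAeq.fderiv
  set F₁ : E4 → E4 →L[ℝ] E4 →L[ℝ] ℝ := fun z ↦ (𝓢.deviationExtend Bf Φ (ψ z)).bilinearComp
    (fderiv ℝ ψ z) (fderiv ℝ ψ z) with hF₁
  set Own : E4 → E4 →L[ℝ] E4 →L[ℝ] ℝ := fun z ↦ (Kerr.bilin (M i) (a i) z).bilinearComp
    (ContinuousLinearMap.id ℝ E4 + E z) (ContinuousLinearMap.id ℝ E4 + E z) - Kerr.bilin (M i) (a i) z with hOwn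
  set Oth : Fin N → E4 → E4 →L[ℝ] E4 →L[ℝ] ℝ := fun j z ↦ (H j (ψ z)).bilinearComp (fderiv ℝ ψ z)
    (fderiv ℝ ψ z) with hOth
  set Rest : E4 → E4 →L[ℝ] E4 →L[ℝ] ℝ := fun z ↦ ∑ j ∈ Finset.univ.erase i, Oth j z with hRest
  have hev : 𝓢.deviationExtend K Ψ₁ =ᶠ[𝓝 y] F₁ + (Own + Rest) := by
    filter_upwards [hev1, hAeq, hfd] with z h1 h2 h3
    rw [h1, h2, h3, Pi.add_apply, Pi.add_apply]
    have hKb : K.bilin z = Kerr.bilin (M i) (a i) z := boostedKerrBilin_one_zero (M i) (a i) z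
    rw [hKb, modelDefect_eq i M a Λ ξ Λt T₀ hbil hH hBb z]
  -- the open set on which the lab deviation is smooth
  set W : Set E4 := {z | z ∈ (U : Set E4) ∧ ∀ j, 0 < Kerr.radius (a j)
      (poincareInv (Λ j (z 0)) (E4.ofTimeSpace (z 0) (ξ j (z 0))) z)} with hW
  have hradc : ∀ j, Continuous fun z : E4 ↦ Kerr.radius (a j)
      (poincareInv (Λ j (z 0)) (E4.ofTimeSpace (z 0) (ξ j (z 0))) z) := by
    intro j
    have h0 : Continuous fun z : E4 ↦ z 0 := (EuclideanSpace.proj (0 : Fin 4) : E4 →L[ℝ] ℝ).continuous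
    have hA : Continuous fun z : E4 ↦ (((Λ j (z 0) : E4 ≃L[ℝ] E4).symm : E4 ≃L[ℝ] E4) : E4 →L[ℝ] E4) :=
      (Theorems.contDiff_lorentz_symm (hΛ j)).continuous.comp h0
    have hc : Continuous fun z : E4 ↦ E4.ofTimeSpace (z 0) (ξ j (z 0)) :=
      (contDiff_centreEvent (hξ j)).continuous
    have hP : Continuous fun z : E4 ↦ poincareInv (Λ j (z 0)) (E4.ofTimeSpace (z 0) (ξ j (z 0))) z := by
      show Continuous fun z : E4 ↦ ((Λ j (z 0) : E4 ≃L[ℝ] E4).symm) (z - E4.ofTimeSpace (z 0) (ξ j (z 0)))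
      exact hA.clm_apply (continuous_id.sub hc)
    exact (Kerr.continuous_radius (a j)).comp hP
  have hWo : IsOpen W := by
    have h2 : IsOpen {z : E4 | ∀ j, 0 < Kerr.radius (a j)
        (poincareInv (Λ j (z 0)) (E4.ofTimeSpace (z 0) (ξ j (z 0))) z)} := by
      rw [Set.setOf_forall]
      exact isOpen_iInter_of_finite fun j ↦ isOpen_lt continuous_const (hradc j)
    exact U.isOpen.inter h2
  -- the painted radii at `ψ y`
  have hψ0 : ψ y 0 = clockMap Λt T₀ y := honestChart_apply_zero Λt (ξ i) T₀ y
  have hown_rad : Kerr.radius (a i) (poincareInv (Λ i (ψ y 0)) (E4.ofTimeSpace (ψ y 0) (ξ i (ψ y 0))) (ψ y)) =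
      Kerr.radius (a i) y := by
    rw [← hrad, hψ0]
    exact radius_poincareInv_honestChart Λt (ξ i) T₀ (a i) y
  have hyW : ψ y ∈ W := by
    refine ⟨hyU, fun j ↦ ?_⟩
    by_cases hj : j = i
    · subst hj; rw [hown_rad]; exact hr
    · exact (hoth j hj).1
  have hFW : ContDiffOn ℝ ∞ (𝓢.deviationExtend Bf Φ) W := by
    intro z hz
    have hb : ContDiffAt ℝ ∞ Bf.bilin z := by
      have := contDiffAt_ansatzBilin' N M a Λ ξ hΛ hξ z hz.2
      refine this.congr_of_eventuallyEq (Filter.Eventually.of_forall fun z' ↦ ?_)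
      show Bb z' = _
      rw [hBb]
      exact congrArg _ (Finset.sum_congr rfl fun j _ ↦ hH j z')
    exact (Spacetime.contDiffAt_deviationExtend_model 𝓢 Bf hΦ ⟨z, hz.1⟩ hb).contDiffWithinAt
  -- first piece: the transported lab deviation
  have hD0 : 0 ≤ D := zero_le_one.trans hD1
  have hD4 : ∀ m ≤ 2, (4 : ℝ) ^ m * m.factorial * D ^ (m + 2) ≤ 32 * D ^ 4 := by
    intro m hm
    have hDm : D ^ (m + 2) ≤ D ^ 4 := pow_le_pow_right₀ hD1 (by omega)
    have hc : (4 : ℝ) ^ m * m.factorial ≤ 32 := by interval_cases m <;> norm_num [Nat.factorial]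
    calc (4 : ℝ) ^ m * m.factorial * D ^ (m + 2) ≤ 32 * D ^ (m + 2) :=
          mul_le_mul_of_nonneg_right hc (by positivity)
      _ ≤ 32 * D ^ 4 := mul_le_mul_of_nonneg_left hDm (by norm_num)
  have hG1b : ∀ m ≤ 2, ‖iteratedFDeriv ℝ m F₁ y‖ ≤ 32 * D ^ 4 * η₁ := by
    intro m hm
    have h := norm_iteratedFDeriv_bilinearComp_fderiv_le' hWo hFW hψc hyW m
      (fun l hl ↦ hdevb l (hl.trans hm)) (fun l hl1 hl2 ↦ hD l hl1 (by omega)) hD1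
    refine h.trans ?_
    calc (4 : ℝ) ^ m * m.factorial * η₁ * D ^ (m + 2) = (4 ^ m * m.factorial * D ^ (m + 2)) * η₁ := by ring
      _ ≤ 32 * D ^ 4 * η₁ := mul_le_mul_of_nonneg_right (hD4 m hm) hη₁
  have hG1c : ∀ m : ℕ, ContDiffAt ℝ m F₁ y := by
    intro m
    have hF : ContDiffAt ℝ ∞ (𝓢.deviationExtend Bf Φ) (ψ y) := (hFW _ hyW).contDiffAt (hWo.mem_nhds hyW)
    have hFA := hF.comp y hψc.contDiffAt
    have hDψ : ContDiffAt ℝ ∞ (fderiv ℝ ψ) y := (hψc.fderiv_right (by simp)).contDiffAt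
    exact ((contDiffWithinAt_bilinearComp_self (s := univ) hFA.contDiffWithinAt
      hDψ.contDiffWithinAt).contDiffAt univ_mem).of_le (by exact_mod_cast le_top)
  -- second piece: the own term
  set s : Set E4 := {z | 0 < Kerr.radius (a i) z} with hs
  have hso : IsOpen s := isOpen_lt continuous_const (Kerr.continuous_radius (a i))
  have hys : y ∈ s := hr
  have hQ : ContDiffOn ℝ ∞ (Kerr.bilin (M i) (a i)) s := fun z hz ↦ (Kerr.contDiffAt_bilin (M i) (a i) hz).contDiffWithinAt
  have hG2b : ∀ m ≤ 2, ‖iteratedFDeriv ℝ m Own y‖ ≤ 30 * CK * ε :=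
    norm_iteratedFDeriv_transport_sub_le hso hys hQ hEc.contDiffOn hε0 hCK hEb hε1
  have hG2c : ∀ m : ℕ, ContDiffAt ℝ m Own y := by
    intro m
    have hKat : ContDiffAt ℝ ∞ (Kerr.bilin (M i) (a i)) y := Kerr.contDiffAt_bilin (M i) (a i) hr
    have hS : ContDiffAt ℝ ∞ (fun z ↦ ContinuousLinearMap.id ℝ E4 + E z) y := contDiffAt_const.add hEc.contDiffAt
    exact (((contDiffWithinAt_bilinearComp_self (s := univ) hKat.contDiffWithinAt
      hS.contDiffWithinAt).contDiffAt univ_mem).sub hKat).of_le (by exact_mod_cast le_top)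
  -- third piece: the other holes
  have hG3b : ∀ j ≠ i, ∀ m ≤ 2, ‖iteratedFDeriv ℝ m (Oth j) y‖ ≤ 32 * D ^ 4 * η₂ := by
    intro j hj m hm
    set Wj : Set E4 := {z | 0 < Kerr.radius (a j) (poincareInv (Λ j (z 0))
      (E4.ofTimeSpace (z 0) (ξ j (z 0))) z)} with hWj
    have hWjo : IsOpen Wj := isOpen_lt continuous_const (hradc j)
    have hHW : ContDiffOn ℝ ∞ (H j) Wj := fun z hz ↦ by
      have h := (contDiffAt_boostedKerrBilin_modulated (M j) (a j) (hΛ j) (hξ j) hz).sub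
        (contDiffAt_const (c := (Minkowski.bilin : E4 →L[ℝ] E4 →L[ℝ] ℝ)))
      refine (h.congr_of_eventuallyEq (Filter.Eventually.of_forall fun z' ↦ ?_)).contDiffWithinAt
      exact hH j z'
    have h := norm_iteratedFDeriv_bilinearComp_fderiv_le' hWjo hHW hψc (x := y) (hoth j hj).1 m
      (fun l hl ↦ (hoth j hj).2 l (hl.trans hm)) (fun l hl1 hl2 ↦ hD l hl1 (by omega)) hD1
    refine h.trans ?_
    calc (4 : ℝ) ^ m * m.factorial * η₂ * D ^ (m + 2) = (4 ^ m * m.factorial * D ^ (m + 2)) * η₂ := by ring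
      _ ≤ 32 * D ^ 4 * η₂ := mul_le_mul_of_nonneg_right (hD4 m hm) hη₂
  have hG3c : ∀ j ≠ i, ∀ m : ℕ, ContDiffAt ℝ m (Oth j) y := by
    intro j hj m
    have hHat : ContDiffAt ℝ ∞ (H j) (ψ y) := by
      have h := (contDiffAt_boostedKerrBilin_modulated (M j) (a j) (hΛ j) (hξ j) (hoth j hj).1).sub
        (contDiffAt_const (c := (Minkowski.bilin : E4 →L[ℝ] E4 →L[ℝ] ℝ)))
      exact h.congr_of_eventuallyEq (Filter.Eventually.of_forall fun z' ↦ hH j z')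
    have hFA := hHat.comp y hψc.contDiffAt
    have hDψ : ContDiffAt ℝ ∞ (fderiv ℝ ψ) y := (hψc.fderiv_right (by simp)).contDiffAt
    exact ((contDiffWithinAt_bilinearComp_self (s := univ) hFA.contDiffWithinAt
      hDψ.contDiffWithinAt).contDiffAt univ_mem).of_le (by exact_mod_cast le_top)
  have hsumc : ∀ m : ℕ, ContDiffAt ℝ m Rest y := fun m ↦
    ContDiffAt.sum fun j hj ↦ hG3c j (Finset.ne_of_mem_erase hj) m
  -- assemble
  intro m hm
  have hsumb : ∑ j ∈ Finset.univ.erase i, ‖iteratedFDeriv ℝ m (Oth j) y‖ ≤ N * (32 * D ^ 4 * η₂) :=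
    calc ∑ j ∈ Finset.univ.erase i, ‖iteratedFDeriv ℝ m (Oth j) y‖
        ≤ ∑ j ∈ Finset.univ.erase i, 32 * D ^ 4 * η₂ :=
          Finset.sum_le_sum fun j hj ↦ hG3b j (Finset.ne_of_mem_erase hj) m hm
      _ = (Finset.univ.erase i).card * (32 * D ^ 4 * η₂) := by rw [Finset.sum_const, nsmul_eq_mul]
      _ ≤ N * (32 * D ^ 4 * η₂) := by
          refine mul_le_mul_of_nonneg_right ?_ (by positivity)
          have : (Finset.univ.erase i).card ≤ N := (Finset.card_erase_le).trans (by simp)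
          exact_mod_cast this
  have hRest : ‖iteratedFDeriv ℝ m Rest y‖ ≤ N * (32 * D ^ 4 * η₂) := by
    rw [hRest, iteratedFDeriv_fun_sum_apply fun j hj ↦ hG3c j (Finset.ne_of_mem_erase hj) m]
    exact (norm_sum_le _ _).trans hsumb
  rw [(hev.iteratedFDeriv ℝ m).eq_of_nhds,
    iteratedFDeriv_add_apply (f := F₁) (g := Own + Rest) (hG1c m) (by exact (hG2c m).add (hsumc m)),
    iteratedFDeriv_add_apply (f := Own) (g := Rest) (hG2c m) (hsumc m)]
  linarith [norm_add_le (iteratedFDeriv ℝ m F₁ y) (iteratedFDeriv ℝ m Own y + iteratedFDeriv ℝ m Rest y),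
    norm_add_le (iteratedFDeriv ℝ m Own y) (iteratedFDeriv ℝ m Rest y), hG1b m hm, hG2b m hm]

end PointBound

/-- Registered one-line form (worker carrier `rechart_transport_constant_le`). [folklore] -/
theorem rechart_transport_constant_le : ∀ {D : ℝ}, 1 ≤ D → ∀ m ≤ 2, (4 : ℝ) ^ m * m.factorial * D ^ (m + 2) ≤ 32 * D ^ 4 := by
  intro D hD1 m hm
  have hDm : D ^ (m + 2) ≤ D ^ 4 := pow_le_pow_right₀ hD1 (by omega)
  have hc : (4 : ℝ) ^ m * m.factorial ≤ 32 := by interval_cases m <;> norm_num [Nat.factorial]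
  have hD0 : 0 ≤ D := zero_le_one.trans hD1
  calc (4 : ℝ) ^ m * m.factorial * D ^ (m + 2) ≤ 32 * D ^ (m + 2) :=
        mul_le_mul_of_nonneg_right hc (by positivity)
    _ ≤ 32 * D ^ 4 := mul_le_mul_of_nonneg_left hDm (by norm_num)

end Summit.FinalStateConjecture.FinalStateConjecture.Theorems.SublinearIsFree.Rechart

end
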